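import Summits.HodgeConjecture.HodgeConjecture.Theorems.Ring2AbelianAllAndreMinimal
import Literature.AlgebraicGeometry.HodgeTheory.LefschetzStandardConjectureFacts
import Literature.AlgebraicGeometry.Motives.SegreEmbedding
import HarnessLib

/-!
# Ring 2 · sub-cell AbelianAll (ALL ABELIAN VARIETIES), André axis, part II — the Lefschetz-`B` candidates
# for `B_min` (standard conjecture `B` for the TOTAL SPACE of a compact pencil of abelian varieties), the rows
# through Milne 2020 Prop. 1, and the fact-free existential node

HONEST FRAMING (page 1, verbatim): **research route, not a corollary; conditional on HC_CM plus one named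
minimal statement.** Cell line: research route conditional on HC_CM; not a corollary; Q11.4-sentence-2
already refuted in dim ≥ 3. Nothing in this file proves a case of the Hodge conjecture. `HC_CM` =
`Theses.RankFourFaces.CMAbelianHodge` (a BINDER, never cited), `HC_AV` = `Theses.PadicSemiregularLift.HodgeAbelianVarieties`,
the reduction item `Theses.RankFourFaces.CMToAbelian` (stmt-16267) is OPEN and not closed here. Part I
(`Ring2AbelianAllAndreMinimal`) typed the transport candidates (3) `CMPointedPencilVHC`, (4) `CMAnchoredTransport`,
the lift nodes (L) `CMFibreAlgebraicLift`, (L∀) `AlgebraicFixedPart`, and proved `HC_AV_of_HC_CM_and_Bmin`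
(`B_min` := (4), modulo André's Lemme 6.3.1). This part adds (seat `pub-hodge-ring2-ab-andre-2`):

* §D the LEFSCHETZ side (REFEREE-AB R-01 (iii) 5, F-ab-2, R-ab-2): (5∀) `LefschetzBCompactPencils` — André's
  Remarque 2 (p. 33) verbatim: conjecture `B` (in the tree's `*_L`-form `StandardConjectureBStar`) for the total
  space of EVERY compact pencil of abelian varieties — and (5) `LefschetzBCMPointedPencils` (only pencils with a
  CM fibre). The edge "`B` of the total space ⟹ transport along the pencil" is Milne 2020, Prop. 1
  [Milne2020HodgeClassesAV, Prop. 1 (p. 7)] (= Abdulali 1994, p. 1122): "Let `f : A → S` be an abelian scheme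
  over a smooth complete complex variety `S`. Assume that the Lefschetz standard conjecture holds for `A`. Let
  `t` be a global section of the sheaf `R^{2r}f_*ℚ(r)`; if `t_s` is algebraic for one `s`, then it is
  algebraic for all `s`." It is NOT vendored here (Literature request R-ab-2 of the sub-cell, seat andre-1);
  it enters as the explicit HYPOTHESIS SHAPE `Milne2020Prop1[]` (local notation; body: a compact pencil whose
  total space satisfies `StandardConjectureBStar` in every degree satisfies `Abdulali1994.InvariantCyclesHoldFor`).
  Faithfulness of the shape: Milne's hypothesis is Grothendieck's `A(A, L)` for a hyperplane class (his
  definition, p. 7); the `B*`-form for every polarisation class is STRONGER in print (Kleiman 1968, `B ⇒ A`;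
  hard Lefschetz for hyperplane classes), so the shape is implied by the printed proposition; a compact pencil
  in the tree's sense (smooth projective family over a smooth projective curve, with a section, abelian fibres)
  is an abelian scheme over a smooth complete curve (Mumford, GIT, Thm. 6.14). Until the named fact lands every
  row below carries `hM : Milne2020Prop1[]` explicitly.
* §E the EXISTENTIAL node (T∃) `CMAnchoredPencilTransport`: per Hodge class, SOME CM-anchored compact pencil
  (the data of Lemme 6.3.1, `Andre1996.IsCMAnchoredPencilFor`) along which algebraicity spreads out of CM
  fibres. It is the weakest statement of the two parts proved sufficient, the only one reaching `HC_AV` from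
  `HC_CM` with NO named fact, and the only one that is `HC_CM`-complementary in PRINT as well (its pencils
  carry no anchor but a CM fibre; compare part I, honest column).

Kernel edges of this part: (5∀) ⟹ (5); (5) ⟹ (3) and (5∀) ⟹ (2) modulo `hM`; `HC_CM ∧ (5) ⟹ HC_AV` modulo
`hM` and Lemme 6.3.1; KIND-1 witness (5∀) ⟹ `HC_AV` with NO `HC_CM` modulo `hM` and Lemmes 6.3.1–6.3.3
(Milne's Thm. 4 on compact pencils); `HodgeConjecture ⟹ (5∀)` modulo the tree fact
`Kleiman1968_lefschetzInvolution_algebraic_of_hodgeClasses_prod` (`HC(X × X) ⇒ B(X)`), so (5), (5∀) are CASES of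
the summit; `(4) ∧ Lemme 6.3.1 ⟹ (T∃)`; `HC_AV ⟹ (T∃)` (mod 6.3.1); `HC_CM ∧ (T∃) ⟹ HC_AV` (no fact);
EXACTNESS `HC_AV ↔ HC_CM ∧ (T∃)` (mod 6.3.1); the chain (5∀) ⟹ (5) ⟹ (3) ⟹ (4) ⟹ (T∃), (L∀) ⟹ (L) ⟹ (4).
NOT claimed (OPEN): (5) ⟹ (5∀), (T∃) ⟹ (4), and `B` for any single total space. What `B` is ABOUT here:
Lieberman's theorem (`B` for abelian varieties, tree fact `Lieberman1968_lefschetzInvolution_algebraic_abelianVariety`)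
covers the FIBRES; the open statement is `B` for the `(d+1)`-dimensional total space `𝒳`, which is not an
abelian variety — for the pencils of Lemme 6.3.1 through a `g`-fold `A`, a `(2g+1)`-fold fibred in abelian
`2g`-folds over a compact Shimura-type curve.

References: Andre1996Motifs (Lemme 6.3.1, Remarque 2, pp. 31–33); Milne2020HodgeClassesAV (Prop. 1, Thm. 4,
pp. 7–8); Abdulali1994FamiliesAV (p. 1122, Lemma 6.2); Kleiman1968AlgebraicCycles (§2); Lieberman1968;
Voisin2025 (§3.2.2); Grothendieck1968 (§3, B(X)); MumfordGIT (Thm. 6.14).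
-/

noncomputable section

set_option linter.dupNamespace false

namespace Summit.HodgeConjecture.HodgeConjecture.Ring2.AbelianAll

open CategoryTheory AlgebraicGeometry MonoidalCategory
open Literature.AlgebraicGeometry Literature.AlgebraicGeometry.Motives
open Literature.AlgebraicGeometry.HodgeTheory
open Literature.AlgebraicGeometry.Milne1999 (IsOfCMType)
open Literature.AlgebraicGeometry.Abdulali1994 (InvariantCyclesHoldFor)
open Literature.AlgebraicGeometry.Andre1996 (andre1996_cmAnchoredPencil
  andre1996_cmHodgeClasses_algebraicallyAnchoredPencils IsCMAnchoredPencilFor)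
open Literature.AlgebraicGeometry.Deligne1982 (cmLocus)
open Summit.HodgeConjecture.HodgeConjecture
open Summit.HodgeConjecture.HodgeConjecture.Theses
open Summit.HodgeConjecture.HodgeConjecture.Ring2.Deform (CompactAbelianPencilVHC compactAbelianPencilVHC_of_HC_AV
  HC_AV_of_andre1996_of_compactAbelianPencilVHC HC_CM_of_HC_AV HC_AV_of_hodgeConjecture)
open Summit.HodgeConjecture.HodgeConjecture.Theorems.HodgeAbelianVarieties.Negative (iff_hodgeConjecture_restricted)

variable {𝒳 S : SchemeOver ℂ}

/-! ## §D The Lefschetz-`B` candidates (5), (5∀) and the rows through Milne 2020 Prop. 1 -/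

/-- **(5∀) `LefschetzBCompactPencils` — Grothendieck's standard conjecture `B`, in André's `*_L`-form, for the
TOTAL SPACE of every compact pencil of abelian varieties** (André 1996, Remarque 2, p. 33, verbatim target:
"Ce théorème ramène … la conjecture de Hodge pour les variétés abéliennes à la question de savoir si
l'involution de Lefschetz (ou de Hodge) sur les pinceaux compacts de variétés abéliennes est donnée par une
correspondance algébrique"): for `f : 𝒳 ⟶ S` a compact pencil of relative dimension `d` and every
`η ∈ H²(𝒳(ℂ); ℂ)`, `StandardConjectureBStar (d + 1) 𝒳 η` (for every polarisation class `η` of the smooth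
projective `(d+1)`-fold `𝒳`, each `*_L : Hᵃ → Hᵇ` is induced by an algebraic class on `𝒳 × 𝒳`). OPEN — `B`
is known for curves, surfaces, abelian varieties (Lieberman; here the FIBRES, not `𝒳`), flag varieties;
`𝒳` is none of these for `d ≥ 2`. With Milne's Prop. 1 and Lemmes 6.3.1–6.3.3 it gives `HC_AV` with NO
`HC_CM` (`HC_AV_of_andre1996_of_milne_of_lefschetzBCompactPencils`, KIND 1).
[cite: Andre1996Motifs, Remarque 2 (p. 33)] [cite: Grothendieck1968, §3 p. 196 (B(X))]
[cite: Milne2020HodgeClassesAV, Thm. 4 and Prop. 1 (pp. 7–8)] -/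
@[conjecture] def LefschetzBCompactPencils : Prop :=
  ∀ ⦃d : ℕ⦄ ⦃𝒳 S : SchemeOver ℂ⦄ (f : 𝒳 ⟶ S), IsCompactAbelianPencil f d →
    ∀ η : complexBetti 𝒳 2, StandardConjectureBStar (d + 1) 𝒳 η

/-- **(5) `LefschetzBCMPointedPencils` — the same for compact pencils of abelian varieties HAVING A CM FIBRE**
(REFEREE-AB R-01 (iii) 5: "the open content is `B` for the `(2g+1)`-dimensional total space" of the
CM-anchored pencil of Lemme 6.3.1). OPEN; a HYPOTHESIS wherever used; with Milne's Prop. 1 it gives (3), hence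
with `HC_CM` and Lemme 6.3.1, `HC_AV` (`HC_AV_of_HC_CM_of_milne_of_lefschetzBCMPointedPencils`).
[cite: Andre1996Motifs, Lemme 6.3.1 (p. 31) and Remarque 2 (p. 33)] [cite: Milne2020HodgeClassesAV, Prop. 1 (p. 7)] -/
@[conjecture] def LefschetzBCMPointedPencils : Prop :=
  ∀ ⦃d : ℕ⦄ ⦃𝒳 S : SchemeOver ℂ⦄ (f : 𝒳 ⟶ S), IsCompactAbelianPencil f d → (cmLocus f d).Nonempty →
    ∀ η : complexBetti 𝒳 2, StandardConjectureBStar (d + 1) 𝒳 η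

/-- (5∀) ⟹ (5). [folklore] -/
theorem lefschetzBCMPointedPencils_of_lefschetzBCompactPencils (h : LefschetzBCompactPencils) :
    LefschetzBCMPointedPencils :=
  fun _ _ _ f hf _ ↦ h f hf

/-- ON-PATH: `HodgeConjecture ⟹ (5∀)`, modulo the tree fact "`HC(X × X) ⇒ B(X)`"
(`Kleiman1968_lefschetzInvolution_algebraic_of_hodgeClasses_prod`): the total space `𝒳` is smooth projective of
dimension `d + 1`, so is `𝒳 × 𝒳` of dimension `2(d+1)` (`IsSmoothProjective.tensor_holds`), and the inverse
Lefschetz isomorphisms are Hodge classes on it. So (5∀), (5) are CASES of the summit, not independent axioms.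
[cite: Voisin2025, §3.2.2 (15)–(16) and Lemma 2.9] [cite: Kleiman1968AlgebraicCycles, §2] -/
theorem lefschetzBCompactPencils_of_hodgeConjecture
    (hK : Kleiman1968_lefschetzInvolution_algebraic_of_hodgeClasses_prod) (h : _root_.HodgeConjecture) :
    LefschetzBCompactPencils :=
  fun _ _ _ _ hf η ↦ hK hf.isSmoothProjective_total
    (h (IsSmoothProjective.tensor_holds hf.isSmoothProjective_total hf.isSmoothProjective_total)) η

/-- `Milne2020Prop1[]` — the SHAPE in which §D consumes Milne 2020, Prop. 1 (= Abdulali 1994, p. 1122), restricted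
to compact pencils and with "the Lefschetz standard conjecture holds for the total space" rendered in the tree's
`B*`-form in every degree: such a pencil satisfies Grothendieck's transport of algebraicity. A THEOREM in print
(12-line proof: `θ_n`-splitting of Leray for the abelian scheme, `B` of the fibre (Lieberman), `B` of the total
space); NOT vendored in this Summit-side file (Literature request R-ab-2 of the sub-cell; until the named fact
lands, every row below carries it as an explicit hypothesis `hM`). Local notation only; not a definition.
[cite: Milne2020HodgeClassesAV, Prop. 1 (p. 7)] [cite: Abdulali1994FamiliesAV, p. 1122] -/
local notation3 (prettyPrint := false) "Milne2020Prop1[]" =>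
  ∀ ⦃d : ℕ⦄ ⦃𝒳 S : SchemeOver ℂ⦄ (f : 𝒳 ⟶ S), IsCompactAbelianPencil f d →
    (∀ η : complexBetti 𝒳 2, StandardConjectureBStar (d + 1) 𝒳 η) → InvariantCyclesHoldFor f d

/-- **(5) ⟹ (3), modulo Milne's Prop. 1.** [cite: Milne2020HodgeClassesAV, Prop. 1 (p. 7)] -/
theorem cmPointedPencilVHC_of_milne_of_lefschetzBCMPointedPencils (hM : Milne2020Prop1[])
    (hB : LefschetzBCMPointedPencils) : CMPointedPencilVHC :=
  fun _ _ _ f hf hcm ↦ hM f hf (hB f hf hcm)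

/-- **(5∀) ⟹ (2), modulo Milne's Prop. 1** (Milne's Thm. 4 restricted to compact pencils: "it suffices to check
(c) with `S` a complete smooth curve … This Proposition 1 does"). [cite: Milne2020HodgeClassesAV, Thm. 4 (p. 8)] -/
theorem compactAbelianPencilVHC_of_milne_of_lefschetzBCompactPencils (hM : Milne2020Prop1[])
    (hB : LefschetzBCompactPencils) : CompactAbelianPencilVHC :=
  fun _ _ _ f hf ↦ hM f hf (hB f hf)

/-- **The Lefschetz-flavoured deliverable: `HC_CM → (5) → HC_AV`, modulo Lemme 6.3.1 (`h₂₁`) and Milne's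
Prop. 1 (`hM`), both theorems in print.** The open content of (5) is `B` for the `(2·dim A + 1)`-dimensional
total spaces of the CM-anchored pencils of Lemme 6.3.1 — not `B` for abelian varieties (Lieberman, known).
research route, not a corollary; conditional on HC_CM plus one named minimal statement.
[cite: Andre1996Motifs, Lemme 6.3.1 (p. 31) and Remarque 2 (p. 33)] [cite: Milne2020HodgeClassesAV, Prop. 1 (p. 7)] -/
theorem HC_AV_of_HC_CM_of_milne_of_lefschetzBCMPointedPencils (h₂₁ : andre1996_cmAnchoredPencil)
    (hM : Milne2020Prop1[]) (hCM : RankFourFaces.CMAbelianHodge) (hB : LefschetzBCMPointedPencils) :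
    PadicSemiregularLift.HodgeAbelianVarieties :=
  HC_AV_of_HC_CM_and_cmPointedPencilVHC h₂₁ hCM (cmPointedPencilVHC_of_milne_of_lefschetzBCMPointedPencils hM hB)

/-- **KIND-1 witness for (5∀)** (André's Remarque 2 = Milne's Thm. 4 on compact pencils): granted Lemmes
6.3.1–6.3.3 and Milne's Prop. 1, `B` for the total spaces of ALL compact pencils of abelian varieties gives
`HC_AV` with NO `HC_CM`. The restriction to CM-pointed pencils in (5) is what keeps `HC_CM` load-bearing in the
kernel (part I module docstring, honest column). [cite: Andre1996Motifs, Remarque 2 (p. 33)]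
[cite: Milne2020HodgeClassesAV, Thm. 4 (p. 8)] -/
theorem HC_AV_of_andre1996_of_milne_of_lefschetzBCompactPencils (h₂₁ : andre1996_cmAnchoredPencil)
    (h₂₂ : andre1996_cmHodgeClasses_algebraicallyAnchoredPencils) (hM : Milne2020Prop1[])
    (hB : LefschetzBCompactPencils) : PadicSemiregularLift.HodgeAbelianVarieties :=
  HC_AV_of_andre1996_of_compactAbelianPencilVHC h₂₁ h₂₂
    (compactAbelianPencilVHC_of_milne_of_lefschetzBCompactPencils hM hB)

/-! ## §E The existential node (T∃): the fact-free row, `HC_CM`-complementary in print as well -/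

/-- **(T∃) `CMAnchoredPencilTransport` — every Hodge class on every complex abelian variety is reached, OUT
OF a CM fibre, by a compact pencil of abelian varieties along which its flat extension carries
algebraicity**: for `A` (smooth projective of dimension `dim A`), `p`, and a rational `(p,p)` class `c`, there
are a compact pencil `f : 𝒳 ⟶ S` CM-anchored for `(A, p, c)` in the sense of Lemme 6.3.1
(`Andre1996.IsCMAnchoredPencilFor A p c f`: relative dimension `2·dim A`, a CM fibre, a fibre `𝒳_s ≅ A₁.X`
with `g : A ⟶ A₁`, a fibrewise-Hodge global class `W` with `g^*(W|_{𝒳_s}) = q·c`, `q ≠ 0`) ON WHICH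
algebraicity spreads out of CM fibres (the body of (4) for this one `f`). Lemme 6.3.1 supplies the pencil;
(4) supplies the transport (`cmAnchoredPencilTransport_of_andre1996_of_cmAnchoredTransport`); with `HC_CM`
it gives `HC_AV` with NO named fact (`HC_AV_of_HC_CM_and_cmAnchoredPencilTransport`). In print this node is
NOT known to re-derive `HC_CM` (its pencils need carry no anchor other than a CM fibre). OPEN; a HYPOTHESIS.
[cite: Andre1996Motifs, Lemme 6.3.1 (p. 31) and §6.3 a) (p. 33)] [cite: Abdulali1994FamiliesAV, Lemma 6.2 (p. 1131)] -/
@[conjecture] def CMAnchoredPencilTransport : Prop :=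
  ∀ (A : AbelianVariety ℂ), IsSmoothProjective A.dim A.X →
    ∀ (p : ℕ) (c : complexBetti A.X (2 * p)), IsRationalClass c → IsOfHodgeType A.dim A.X (2 * p) p p c →
      ∃ (𝒳 S : SchemeOver ℂ) (f : 𝒳 ⟶ S), IsCMAnchoredPencilFor A p c f ∧
        ∀ (p' : ℕ) (W : complexBetti 𝒳 (2 * p')),
          (∀ s : ComplexPoints S, IsRationalClass (complexBetti.map (fiberι f s) (2 * p') W) ∧
            IsOfHodgeType (2 * A.dim) (fiberOver f s) (2 * p') p' p'
              (complexBetti.map (fiberι f s) (2 * p') W)) →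
          ∀ t ∈ cmLocus f (2 * A.dim),
            complexBetti.map (fiberι f t) (2 * p') W ∈ algebraicClasses (fiberOver f t) p' →
            ∀ s : ComplexPoints S,
              complexBetti.map (fiberι f s) (2 * p') W ∈ algebraicClasses (fiberOver f s) p'

/-- **Lemme 6.3.1 ∧ (4) ⟹ (T∃)**. [cite: Andre1996Motifs, Lemme 6.3.1 (p. 31)] -/
theorem cmAnchoredPencilTransport_of_andre1996_of_cmAnchoredTransport (h₂₁ : andre1996_cmAnchoredPencil)
    (hB : CMAnchoredTransport) : CMAnchoredPencilTransport := by
  intro A hA p c hc hpp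
  obtain ⟨𝒳, S, f, hf⟩ := h₂₁ A hA p c hc hpp
  exact ⟨𝒳, S, f, hf, fun p' W hW t ht h₀ s ↦ hB f hf.1 p' W hW t ht h₀ s⟩

/-- ON-PATH: `HC_AV ⟹ (T∃)`, modulo Lemme 6.3.1. [cite: Andre1996Motifs, Lemme 6.3.1 (p. 31)] -/
theorem cmAnchoredPencilTransport_of_andre1996_of_HC_AV (h₂₁ : andre1996_cmAnchoredPencil)
    (h : PadicSemiregularLift.HodgeAbelianVarieties) : CMAnchoredPencilTransport :=
  cmAnchoredPencilTransport_of_andre1996_of_cmAnchoredTransport h₂₁ (cmAnchoredTransport_of_HC_AV h)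

/-- **`HC_CM ∧ (T∃) ⟹ HC_AV` — NO named fact.** The proof of `HC_AV_of_HC_CM_and_Bmin` with the pencil and
the transport both read off (T∃). research route, not a corollary; conditional on HC_CM plus one named minimal
statement. [cite: Andre1996Motifs, §6.3 a) (p. 33)] [cite: Abdulali1994FamiliesAV, Lemma 6.2 (p. 1131)] -/
theorem HC_AV_of_HC_CM_and_cmAnchoredPencilTransport (hCM : RankFourFaces.CMAbelianHodge)
    (hT : CMAnchoredPencilTransport) : PadicSemiregularLift.HodgeAbelianVarieties := by
  refine iff_hodgeConjecture_restricted.2 fun A hA ↦ ?_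
  refine (hodgeConjectureFor_iff_of_isSmoothProjective nonempty_hodgeModel_holds hA).2 fun p c hc hpp ↦ ?_
  obtain ⟨𝒳, S, f, ⟨hf, s, t, W, A₁, A₀, e₁, g, q, hW, hq, hgc, ⟨e₀⟩, hA₀⟩, hT'⟩ := hT A hA p c hc hpp
  have h₀ : complexBetti.map (fiberι f t) (2 * p) W ∈ algebraicClasses (fiberOver f t) p :=
    Ring2Transport.mem_algebraicClasses_of_cmChart hCM A₀ e₀ (Andre1996.compactPencil_dim_eq_of_iso hf e₀)
      hA₀ (hW t).1 (hW t).2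
  have h₁ := hT' p W hW t (mem_cmLocus_of_compactPencil hf e₀ hA₀) h₀ s
  have h₂ : complexBetti.map e₁.hom (2 * p) (complexBetti.map (fiberι f s) (2 * p) W) ∈
      algebraicClasses A₁.X p :=
    (mem_algebraicClasses_map_iff_of_iso e₁).2 h₁
  have h₃ : (q : ℂ) • c ∈ algebraicClasses A.X p := by
    rw [← hgc]
    exact map_mem_algebraicClasses_of_abelianVariety hA A₁ g.hom.hom.hom h₂
  exact (Submodule.smul_mem_iff _ (Rat.cast_ne_zero.2 hq)).1 h₃

/-- EXACTNESS of (T∃): granted Lemme 6.3.1, `HC_AV ↔ HC_CM ∧ CMAnchoredPencilTransport`.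
[cite: Andre1996Motifs, Lemme 6.3.1 (p. 31)] -/
theorem HC_AV_iff_HC_CM_and_cmAnchoredPencilTransport (h₂₁ : andre1996_cmAnchoredPencil) :
    PadicSemiregularLift.HodgeAbelianVarieties ↔ (RankFourFaces.CMAbelianHodge ∧ CMAnchoredPencilTransport) :=
  ⟨fun h ↦ ⟨HC_CM_of_HC_AV h, cmAnchoredPencilTransport_of_andre1996_of_HC_AV h₂₁ h⟩,
    fun h ↦ HC_AV_of_HC_CM_and_cmAnchoredPencilTransport h.1 h.2⟩

/-- **The chain of the two parts in one statement** (strongest to weakest sufficient input, each arrow a theorem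
above; `hM` = Milne's Prop. 1, `h₂₁` = Lemme 6.3.1): (5∀) ⟹ (5) ⟹ (3) ⟹ (4) ⟹ (T∃), and (L∀) ⟹ (L) ⟹ (4).
[cite: Andre1996Motifs, §6.3 (pp. 31–33)] [cite: Milne2020HodgeClassesAV, Prop. 1 (p. 7)] -/
theorem chain (hM : Milne2020Prop1[]) (h₂₁ : andre1996_cmAnchoredPencil) :
    (LefschetzBCompactPencils → LefschetzBCMPointedPencils) ∧ (LefschetzBCMPointedPencils → CMPointedPencilVHC) ∧
      (CMPointedPencilVHC → CMAnchoredTransport) ∧ (CMAnchoredTransport → CMAnchoredPencilTransport) ∧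
      (AlgebraicFixedPart → CMFibreAlgebraicLift) ∧ (CMFibreAlgebraicLift → CMAnchoredTransport) :=
  ⟨lefschetzBCMPointedPencils_of_lefschetzBCompactPencils,
    cmPointedPencilVHC_of_milne_of_lefschetzBCMPointedPencils hM, cmAnchoredTransport_of_cmPointedPencilVHC,
    cmAnchoredPencilTransport_of_andre1996_of_cmAnchoredTransport h₂₁, cmFibreAlgebraicLift_of_algebraicFixedPart,
    cmAnchoredTransport_of_cmFibreAlgebraicLift⟩

end Summit.HodgeConjecture.HodgeConjecture.Ring2.AbelianAll

end
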